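import Summits.QuantumFields.BalabanUV.T4Continuum.Support.AveragingDeficitDualResidualWUnit
import Summits.QuantumFields.BalabanUV.T4Continuum.Support.NE3CovariantWeitzenbock
import HarnessLib

/-!
# AveragingDeficitDualResidualCD (T⁴ programme, node NE3, row NE3-R2, gen 6) — R2ᴱ_cd: THE CURL-AND-DIVERGENCE-PAIRED DUAL
# RESIDUAL OF THE GRADIENT-LIFT ROAD — (γ2) ∘ (γ3), with (γ3) = the covariant Weitzenböck inequality of row E-MLw-w4-W
# (`NE3CovariantWeitzenbock.covGradSq_le`, leaf-03) TAKEN BY NAME (record `t4/T4-EST-NE3-R2.md` v0.8 §5)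

HONEST FRAMING (cell `pub-balaban`, T4-DAG PAGE 1; unit `b2b-balaban-t4-ne3r2-p1` = owner of BINDER-OWNERS row NE3-R2, gen 6).
The cell's T4 target is the finite-torus continuum limit of the unit-scale averaged loop expectations — NOT infinite volume, NO
mass gap, NOT Clay, NOT summit progress.  WHY.  R2ᴱ_w (`AveragingDeficitDualResidualW∕WUnit`, this row) pairs the first variation
`⟨J(V̄), φ⟩ = dAction V̄ φ` of the fine Wilson action at the block average `V̄ = cavg L U` of a constrained minimiser with the
covariant GRADIENT energy `covGradSq V̄ φ` of the direction `φ`; the step announced as (γ3) — «`covGradSq V̄ φ ≲ curlSq + divSq +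
O(a)·dirSq` on the torus» — is IN THE TREE BY NAME: `NE3CovariantWeitzenbock.covGradSq_le` (row E-MLw-w4-W of the NE3 crew), for
any unitary periodic background in a small-field class.  THIS FILE composes the two (0 sorry, all [folklore]):
§1 the coarse small-field radius `prop1Radius d L a` of `V̄` (this row's `smallField_cavg`) is `≤ cRad(d,L)·a` and `≤ 1` under the
   512-smallness (`prop1Radius_le_cRad_mul`, `prop1Radius_le_one`), so the Weitzenböck `a`-coefficient `2d·a₁ + 32d·a₁²` is
   `≤ 34·d·cRad·a` (`weitz_coeff_le`);
§2 **`covGradSq_cavg_le`**: `covGradSq V̄ φ (periodBox M) ≤ N·(2·Σ_{p} ‖(d_V̄ φ)(p)‖²_HS + Σ_x ‖(D*_V̄ φ)(x)‖²_HS) + N·34d·cRad·a·dirSq φ`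
   (`N = card n`; `covDiv` = the covariant backward divergence of `NE3CovariantWeitzenbock`), and the operator-curl weakening
   `sum_plaqsOf_nhsNormSq_curl_le` (`Σ_p ‖·‖²_HS ≤ curlSq`);
§3 **`dAction_cavg_le_curl_div_torus`**: for `U` unitary of period `L·M` in `SmallField U a` (512-small), `FineCriticalAll L M U Tc`,
   `φ` skew `M`-periodic with `Tc φ`:
   `L^{d−4}·|dAction V̄ φ| ≤ wallConst·[ √gradFluxSq U · √( cW₁·N·(2·curl_HS + div_HS) + (cW₁·N·34d·cRad·a + cW₂·a²)·dirSq φ )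
     + a²·(cW₃·covGradL1 V̄ φ + cW₄·dirL1 φ) ]`, and the same with `curlSq V̄ φ` (`…_torus'`);
§4 **`dAction_cavg_le_curl_div_avgIter`**: the same for Bałaban's `(j+2)`-level constrained minimisers (R0′ discharged by
   `fineCriticalAll_avgIter` inside `dAction_cavg_le_avgIter`).
So on a tangent space carrying a Landau-type condition `D*_V̄ φ = 0` the residual is CURL-PAIRED up to the displayed `a`-weighted
`dirSq` and the `a²·ℓ¹` slots (INFO-1 of XREAD l.15366 applies verbatim: the `a²` constants are large; no smallness is claimed).
This is the gradient-lift road's twin of the (RES♯) socket end `NE3CurlPairedResidualEnd` (spread-lift road, no divergence term);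
nothing here supersedes it.  NE3 ITSELF IS NOT PROVED; nothing of Bałaban's is asserted (context: [Balaban1985Variational]
(26)–(27) p. 282; [Balaban1985BackgroundPropagators] (3.3)–(3.4), (3.8)–(3.10) pp. 390–391).  ABSOLUTE RULE kept: no printed
sentence is a hypothesis.  PLACEMENT: `Summits/QuantumFields/BalabanUV/`; imports this row's `AveragingDeficitDualResidualWUnit`
and the crew's `NE3CovariantWeitzenbock`; moves nothing.
-/

set_option autoImplicit false

open scoped BigOperators Matrix Matrix.Norms.L2Operator
open NormedSpace Finset

namespace Summit.QuantumFields.BalabanUV.T4Continuum.AveragingDeficitDualResidualCD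

open Literature.MathematicalPhysics.QuantumFieldTheory.Balaban1983to89
open B7Prop1Explicit B7Prop2Explicit MatrixLog UnitaryModel MatrixNorms
open T4AveragingDeficitWall hiding Site Plane Plaq Bond
open T4AveragingDeficitWallBoundary (IsPeriodicCfg periodBox)
open AveragingDeficitPeriodicCounting (IsPeriodicDir)
open AveragingDeficitDerivWallProof (wallConst wallConst_nonneg)
open AveragingDeficitChartCalculus (cavg)
open AveragingDeficitCovGrad (covGradSq covGradSq_nonneg)
open AveragingDeficitTwoLevelPrep (prop1Radius cavg_isUnitaryCfg smallField_cavg smallness_of_twoLevelSmall)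
open AveragingDeficitMultiLevelPrep (tower TangentIter LevelSmall prop1Radius_nonneg tower_ne_zero)
open AveragingDeficitFermat (isPeriodicCfg_cavg small512_of_liftSmall)
open NE3HessForm (dAction)
open NE3HessShapes (plaqsOf sum_plaqsOf)
open NE3CovariantWeitzenbock (covDiv covGradSq_le)
open AveragingDeficitLiftDefectSum (covGradL1)
open AveragingDeficitFermatAll (FineCriticalAll)
open AveragingDeficitGradLift (kLift₁)
open AveragingDeficitDualResidualW (cW₁ cW₂ cW₃ cW₄)
open AveragingDeficitDualResidualWUnit (dAction_cavg_le_torus dAction_cavg_le_avgIter)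

noncomputable section

variable {d : ℕ} {n : Type*} [Fintype n] [DecidableEq n]

/-! ## §1 The coarse small-field radius is linear in `a` under the 512-smallness -/

/-- `cRad d L = (1 + 29(d+1)(d+4))·L²`. [folklore] -/
def cRad (d L : ℕ) : ℝ := (1 + 29 * ((d : ℝ) + 1) * ((d : ℝ) + 4)) * (L : ℝ) ^ 2

omit [Fintype n] [DecidableEq n] in
/-- `cRad ≥ 0`. [folklore] -/
theorem cRad_nonneg (d L : ℕ) : 0 ≤ cRad d L := by unfold cRad; positivity

omit [Fintype n] [DecidableEq n] in
/-- Under `512(d+1)(d+4)L²a ≤ 1`: `prop1Radius d L a ≤ cRad(d,L)·a`. [folklore] -/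
theorem prop1Radius_le_cRad_mul {L : ℕ} {a : ℝ} (ha : 0 ≤ a) (h512 : 512 * (d + 1) * (d + 4) * (L : ℝ) ^ 2 * a ≤ 1) :
    prop1Radius d L a ≤ cRad d L * a := by
  unfold prop1Radius cRad
  set x : ℝ := 8 * ((d : ℝ) + 1) * ((d : ℝ) + 4) * (L : ℝ) ^ 2 * a with hx
  have hx0 : 0 ≤ x := by rw [hx]; positivity
  have hx64 : 64 * x ≤ 1 := by rw [hx]; linarith
  have hxx : 64 * x ^ 2 ≤ x := by nlinarith [mul_nonneg hx0 (by linarith : (0 : ℝ) ≤ 1 - 64 * x)]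
  have hkey : 226 * x ^ 2 ≤ 29 * ((d : ℝ) + 1) * ((d : ℝ) + 4) * (L : ℝ) ^ 2 * a := by
    have h1 : 226 * x ^ 2 ≤ 226 / 64 * x := by nlinarith
    have h2 : 226 / 64 * x ≤ 29 / 8 * x := by nlinarith
    have h3 : 29 / 8 * x = 29 * ((d : ℝ) + 1) * ((d : ℝ) + 4) * (L : ℝ) ^ 2 * a := by rw [hx]; ring
    linarith
  nlinarith

omit [Fintype n] [DecidableEq n] in
/-- Under `512(d+1)(d+4)L²a ≤ 1`: `prop1Radius d L a ≤ 1`. [folklore] -/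
theorem prop1Radius_le_one {L : ℕ} {a : ℝ} (ha : 0 ≤ a) (h512 : 512 * (d + 1) * (d + 4) * (L : ℝ) ^ 2 * a ≤ 1) :
    prop1Radius d L a ≤ 1 := by
  unfold prop1Radius
  set x : ℝ := 8 * ((d : ℝ) + 1) * ((d : ℝ) + 4) * (L : ℝ) ^ 2 * a with hx
  have hx0 : 0 ≤ x := by rw [hx]; positivity
  have hx64 : 64 * x ≤ 1 := by rw [hx]; linarith
  have hxx : 64 * x ^ 2 ≤ x := by nlinarith [mul_nonneg hx0 (by linarith : (0 : ℝ) ≤ 1 - 64 * x)]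
  have hL2a : (L : ℝ) ^ 2 * a ≤ x := by
    rw [hx]
    have h0 : 0 ≤ (L : ℝ) ^ 2 * a := by positivity
    have hd : (1 : ℝ) ≤ 8 * ((d : ℝ) + 1) * ((d : ℝ) + 4) := by
      have := Nat.cast_nonneg (α := ℝ) d; nlinarith
    nlinarith
  nlinarith

omit [Fintype n] [DecidableEq n] in
/-- The Weitzenböck `a`-coefficient at the coarse radius: `2d·a₁ + 32d·a₁² ≤ 34·d·cRad·a`. [folklore] -/
theorem weitz_coeff_le {L : ℕ} {a : ℝ} (ha : 0 ≤ a) (h512 : 512 * (d + 1) * (d + 4) * (L : ℝ) ^ 2 * a ≤ 1) :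
    2 * d * prop1Radius d L a + 32 * d * prop1Radius d L a ^ 2 ≤ 34 * d * cRad d L * a := by
  have h1 := prop1Radius_le_cRad_mul (d := d) (L := L) ha h512
  have h2 := prop1Radius_le_one (d := d) (L := L) ha h512
  have h0 : 0 ≤ prop1Radius d L a := prop1Radius_nonneg ha
  have hd : (0 : ℝ) ≤ d := Nat.cast_nonneg d
  have hsq : prop1Radius d L a ^ 2 ≤ prop1Radius d L a := by nlinarith
  nlinarith [mul_le_mul_of_nonneg_left h1 hd, mul_le_mul_of_nonneg_left hsq hd]

/-! ## §2 The coarse covariant gradient energy against the dressed curl and the covariant divergence -/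

omit [Fintype n] [DecidableEq n] in
/-- `cW₁ ≥ 0`. [folklore] -/
theorem cW₁_nonneg (d L : ℕ) : 0 ≤ cW₁ d L := by unfold cW₁ kLift₁; positivity

/-- `Σ_{p ∈ plaqsOf F} ‖(d_V φ)(p)‖²_HS ≤ curlSq V φ F` (`nhsNormSq ≤ ‖·‖²` termwise). [folklore] -/
theorem sum_plaqsOf_nhsNormSq_curl_le (V : Site d → Fin d → (Matrix n n ℂ)ˣ) (φ : Site d → Fin d → Matrix n n ℂ)
    (F : Finset (Site d)) :
    ∑ p ∈ plaqsOf F, nhsNormSq (curl V φ p) ≤ curlSq V φ F := by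
  rw [sum_plaqsOf]
  unfold curlSq
  exact Finset.sum_le_sum fun _ _ => Finset.sum_le_sum fun _ _ => nhsNormSq_le_opNorm_sq _

section Torus

variable [Nonempty n] {L : ℕ} (hL : 1 ≤ L) {U : Site d → Fin d → (Matrix n n ℂ)ˣ} (hU : IsUnitaryCfg U) {a : ℝ} (ha : 0 ≤ a)
  (h512 : 512 * (d + 1) * (d + 4) * (L : ℝ) ^ 2 * a ≤ 1) (hUa : SmallField U a)
include hL hU ha h512 hUa

/-- **(γ3) AT THE BLOCK AVERAGE, BY NAME**: for `U` unitary of period `L·M` in `SmallField U a` (512-small) and an `M`-periodic `φ`,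
`covGradSq (cavg L U) φ (periodBox M) ≤ N·(2·Σ_p ‖(d_V̄ φ)(p)‖²_HS + Σ_x ‖(D*_V̄ φ)(x)‖²_HS) + N·34d·cRad·a·dirSq φ (periodBox M)`
(`NE3CovariantWeitzenbock.covGradSq_le` at `V̄ = cavg L U`, unitary `M`-periodic in `SmallField V̄ (prop1Radius d L a)`). [folklore] -/
theorem covGradSq_cavg_le {M : ℕ} (hM : 1 ≤ M) (hUP : IsPeriodicCfg U ((L : ℤ) * M))
    {φ : Site d → Fin d → Matrix n n ℂ} (hφP : IsPeriodicDir φ (M : ℤ)) :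
    covGradSq (cavg L U) φ (periodBox M)
      ≤ (Fintype.card n : ℝ) * (2 * ∑ p ∈ plaqsOf (periodBox (d := d) M), nhsNormSq (curl (cavg L U) φ p)
            + ∑ x ∈ periodBox (d := d) M, nhsNormSq (covDiv (cavg L U) φ x))
        + (Fintype.card n : ℝ) * (34 * d * cRad d L) * a * dirSq φ (periodBox M) := by
  have hW := cavg_isUnitaryCfg hL hU ha h512 hUa
  have hWP := isPeriodicCfg_cavg L M hUP
  have ha₁ : 0 ≤ prop1Radius d L a := prop1Radius_nonneg ha
  have hWa := smallField_cavg hL hU ha h512 hUa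
  have h := covGradSq_le hM hW hWP ha₁ hWa hφP
  have hcoef := weitz_coeff_le (d := d) (L := L) ha h512
  have hds0 : 0 ≤ dirSq φ (periodBox (d := d) M) := Finset.sum_nonneg fun _ _ => Finset.sum_nonneg fun _ _ => sq_nonneg _
  have hN : (0 : ℝ) ≤ (Fintype.card n : ℝ) := Nat.cast_nonneg _
  have hstep : (Fintype.card n : ℝ) * ((2 * d * prop1Radius d L a + 32 * d * prop1Radius d L a ^ 2) * dirSq φ (periodBox (d := d) M))
      ≤ (Fintype.card n : ℝ) * ((34 * d * cRad d L * a) * dirSq φ (periodBox (d := d) M)) :=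
    mul_le_mul_of_nonneg_left (mul_le_mul_of_nonneg_right hcoef hds0) hN
  calc covGradSq (cavg L U) φ (periodBox M)
      ≤ (Fintype.card n : ℝ) * (2 * ∑ p ∈ plaqsOf (periodBox (d := d) M), nhsNormSq (curl (cavg L U) φ p)
          + ∑ x ∈ periodBox (d := d) M, nhsNormSq (covDiv (cavg L U) φ x)
          + (2 * d * prop1Radius d L a + 32 * d * prop1Radius d L a ^ 2) * dirSq φ (periodBox (d := d) M)) := h
    _ = (Fintype.card n : ℝ) * (2 * ∑ p ∈ plaqsOf (periodBox (d := d) M), nhsNormSq (curl (cavg L U) φ p)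
          + ∑ x ∈ periodBox (d := d) M, nhsNormSq (covDiv (cavg L U) φ x))
        + (Fintype.card n : ℝ) * ((2 * d * prop1Radius d L a + 32 * d * prop1Radius d L a ^ 2)
          * dirSq φ (periodBox (d := d) M)) := by ring
    _ ≤ _ := by linarith

/-! ## §3 R2ᴱ_cd on the torus -/

/-- **R2ᴱ_cd ON THE TORUS (HS curl)**: for `U` unitary of period `L·M` in `SmallField U a` (512-small), `FineCriticalAll L M U Tc`,
and `φ` skew, `M`-periodic with `Tc φ`:
`L^{d−4}·|dAction (cavg L U) φ| ≤ wallConst·[ √gradFluxSq U (periodBox (L·M)) · √( cW₁·N·(2·Σ_p‖d_V̄φ‖²_HS + Σ_x‖D*_V̄φ‖²_HS)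
  + (cW₁·N·34d·cRad·a + cW₂·a²)·dirSq φ ) + a²·(cW₃·covGradL1 V̄ φ + cW₄·dirL1 φ) ]`. [folklore] -/
theorem dAction_cavg_le_curl_div_torus {M : ℕ} (hM : 1 ≤ M) (hUP : IsPeriodicCfg U ((L : ℤ) * M))
    {Tc : (Site d → Fin d → Matrix n n ℂ) → Prop} (hcrit : FineCriticalAll L M U Tc)
    (φ : Site d → Fin d → Matrix n n ℂ) (hφs : ∀ (y : Site d) (κ : Fin d), φ y κ ∈ skewAdjoint (Matrix n n ℂ))
    (hφP : IsPeriodicDir φ (M : ℤ)) (hφT : Tc φ) :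
    (L : ℝ) ^ ((d : ℤ) - 4) * |dAction (cavg L U) φ (periodBox M ×ˢ (Finset.univ : Finset (T4AveragingDeficitWall.Plane d)))|
      ≤ wallConst d L * (Real.sqrt (gradFluxSq U (periodBox (L * M)))
          * Real.sqrt (cW₁ d L * (Fintype.card n : ℝ)
              * (2 * ∑ p ∈ plaqsOf (periodBox (d := d) M), nhsNormSq (curl (cavg L U) φ p)
                + ∑ x ∈ periodBox (d := d) M, nhsNormSq (covDiv (cavg L U) φ x))
            + (cW₁ d L * (Fintype.card n : ℝ) * (34 * d * cRad d L) * a + cW₂ d L * a ^ 2) * dirSq φ (periodBox M))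
        + a ^ 2 * (cW₃ d L * covGradL1 (cavg L U) φ (periodBox M) + cW₄ d L * dirL1 φ (periodBox M))) := by
  have h := dAction_cavg_le_torus hL hU ha h512 hUa hM hUP hcrit φ hφs hφP hφT
  refine h.trans (mul_le_mul_of_nonneg_left ?_ (wallConst_nonneg d L))
  refine add_le_add (mul_le_mul_of_nonneg_left (Real.sqrt_le_sqrt ?_) (Real.sqrt_nonneg _)) le_rfl
  have hcg := covGradSq_cavg_le hL hU ha h512 hUa hM hUP hφP
  have h1 := mul_le_mul_of_nonneg_left hcg (cW₁_nonneg d L)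
  linarith

/-- **R2ᴱ_cd ON THE TORUS (operator curl)**: the same with `curlSq (cavg L U) φ (periodBox M)` in place of the HS plaquette sum. [folklore] -/
theorem dAction_cavg_le_curl_div_torus' {M : ℕ} (hM : 1 ≤ M) (hUP : IsPeriodicCfg U ((L : ℤ) * M))
    {Tc : (Site d → Fin d → Matrix n n ℂ) → Prop} (hcrit : FineCriticalAll L M U Tc)
    (φ : Site d → Fin d → Matrix n n ℂ) (hφs : ∀ (y : Site d) (κ : Fin d), φ y κ ∈ skewAdjoint (Matrix n n ℂ))
    (hφP : IsPeriodicDir φ (M : ℤ)) (hφT : Tc φ) :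
    (L : ℝ) ^ ((d : ℤ) - 4) * |dAction (cavg L U) φ (periodBox M ×ˢ (Finset.univ : Finset (T4AveragingDeficitWall.Plane d)))|
      ≤ wallConst d L * (Real.sqrt (gradFluxSq U (periodBox (L * M)))
          * Real.sqrt (cW₁ d L * (Fintype.card n : ℝ)
              * (2 * curlSq (cavg L U) φ (periodBox M) + ∑ x ∈ periodBox (d := d) M, nhsNormSq (covDiv (cavg L U) φ x))
            + (cW₁ d L * (Fintype.card n : ℝ) * (34 * d * cRad d L) * a + cW₂ d L * a ^ 2) * dirSq φ (periodBox M))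
        + a ^ 2 * (cW₃ d L * covGradL1 (cavg L U) φ (periodBox M) + cW₄ d L * dirL1 φ (periodBox M))) := by
  have h := dAction_cavg_le_curl_div_torus hL hU ha h512 hUa hM hUP hcrit φ hφs hφP hφT
  refine h.trans (mul_le_mul_of_nonneg_left ?_ (wallConst_nonneg d L))
  refine add_le_add (mul_le_mul_of_nonneg_left (Real.sqrt_le_sqrt ?_) (Real.sqrt_nonneg _)) le_rfl
  have hc := sum_plaqsOf_nhsNormSq_curl_le (cavg L U) φ (periodBox (d := d) M)
  have hK : 0 ≤ cW₁ d L * (Fintype.card n : ℝ) := mul_nonneg (cW₁_nonneg d L) (Nat.cast_nonneg _)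
  nlinarith [mul_le_mul_of_nonneg_left hc hK]

end Torus

/-! ## §4 Bałaban's multi-level constrained minimisers -/

/-- **R2ᴱ_cd FOR THE `(j+2)`-LEVEL CONSTRAINED MINIMISERS**: in the setting of `dAction_cavg_le_avgIter` (V unitary of period
`L·(L·tower j)`, `|V(∂p) − 1| ≤ a < b`, `LevelSmall (j+1) b`, minimality among the unitary `U` of the same period with
`|U(∂p) − 1| ≤ b` and the same `(j+2)`-fold average; `φ` skew, `(L·tower j)`-periodic, tangent to the next average) the first
variation is curl-and-divergence-paired:
`L^{d−4}·|dAction V̄ φ| ≤ wallConst·[√gradFluxSq V · √(cW₁·N·(2·curlSq V̄ φ + Σ_x‖D*_V̄φ‖²_HS) + (cW₁·N·34d·cRad·a + cW₂·a²)·dirSq φ)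
  + a²·(cW₃·covGradL1 V̄ φ + cW₄·dirL1 φ)]` (the 512-smallness is RETURNED). [folklore] -/
theorem dAction_cavg_le_curl_div_avgIter [Nonempty n] {L M' : ℕ} [NeZero L] [NeZero M'] (j : ℕ)
    {V : Site d → Fin d → (Matrix n n ℂ)ˣ} (hV : IsUnitaryCfg V) (hVP : IsPeriodicCfg V ((L : ℤ) * (L * tower L M' j : ℕ)))
    {a b : ℝ} (ha : 0 ≤ a) (hab : a < b) (hb : LevelSmall d L (j + 1) b) (hVa : SmallField V a)
    (hmin : ∀ U : Site d → Fin d → (Matrix n n ℂ)ˣ, IsUnitaryCfg U → IsPeriodicCfg U ((L : ℤ) * (L * tower L M' j : ℕ)) →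
      SmallField U b → avgIter L U (j + 2) = avgIter L V (j + 2) →
        fineAction V (blockWindow L (periodBox (L * tower L M' j))).2
          ≤ fineAction U (blockWindow L (periodBox (L * tower L M' j))).2)
    (φ : Site d → Fin d → Matrix n n ℂ) (hφs : ∀ (y : Site d) (κ : Fin d), φ y κ ∈ skewAdjoint (Matrix n n ℂ))
    (hφP : IsPeriodicDir φ ((L * tower L M' j : ℕ) : ℤ)) (hφT : TangentIter L j (cavg L V) φ) :
    ∃ _ : 512 * (d + 1) * (d + 4) * (L : ℝ) ^ 2 * a ≤ 1,
      (L : ℝ) ^ ((d : ℤ) - 4)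
          * |dAction (cavg L V) φ (periodBox (L * tower L M' j) ×ˢ (Finset.univ : Finset (T4AveragingDeficitWall.Plane d)))|
        ≤ wallConst d L * (Real.sqrt (gradFluxSq V (periodBox (L * (L * tower L M' j))))
            * Real.sqrt (cW₁ d L * (Fintype.card n : ℝ)
                * (2 * curlSq (cavg L V) φ (periodBox (L * tower L M' j))
                  + ∑ x ∈ periodBox (d := d) (L * tower L M' j), nhsNormSq (covDiv (cavg L V) φ x))
              + (cW₁ d L * (Fintype.card n : ℝ) * (34 * d * cRad d L) * a + cW₂ d L * a ^ 2)
                * dirSq φ (periodBox (L * tower L M' j)))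
          + a ^ 2 * (cW₃ d L * covGradL1 (cavg L V) φ (periodBox (L * tower L M' j))
              + cW₄ d L * dirL1 φ (periodBox (L * tower L M' j)))) := by
  have hL : 1 ≤ L := Nat.one_le_iff_ne_zero.mpr (NeZero.ne L)
  have hLN : 1 ≤ L * tower L M' j := Nat.one_le_iff_ne_zero.mpr (Nat.mul_ne_zero (NeZero.ne L) (tower_ne_zero L M' j))
  obtain ⟨h512, h⟩ := dAction_cavg_le_avgIter j hV hVP ha hab hb hVa hmin φ hφs hφP hφT
  refine ⟨h512, h.trans (mul_le_mul_of_nonneg_left ?_ (wallConst_nonneg d L))⟩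
  refine add_le_add (mul_le_mul_of_nonneg_left (Real.sqrt_le_sqrt ?_) (Real.sqrt_nonneg _)) le_rfl
  have hcg := covGradSq_cavg_le hL hV ha h512 hVa hLN hVP hφP
  have hc := sum_plaqsOf_nhsNormSq_curl_le (cavg L V) φ (periodBox (d := d) (L * tower L M' j))
  have hK : 0 ≤ cW₁ d L * (Fintype.card n : ℝ) := mul_nonneg (cW₁_nonneg d L) (Nat.cast_nonneg _)
  have h1 := mul_le_mul_of_nonneg_left hcg (cW₁_nonneg d L)
  nlinarith [mul_le_mul_of_nonneg_left hc hK]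

end

end Summit.QuantumFields.BalabanUV.T4Continuum.AveragingDeficitDualResidualCD
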